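/-
VALUE = THEOREM, NOT summit progress (cell b2b-lgcu-borel, gen 22); crux 14079 untouched.
-/
import Mathlib
import Summits.MatrixMultiplication.MatrixMultiplication.Theorems.SubgroupIdentityDesigns.Negative.SplitFunctional

/-!
# The cyclic-index functional with FIXERS: a character-free exclusion of `N ⋊ ⟨q⟩`

VALUE = THEOREM (every `p`, every `m`, every `ε`), NOT summit progress.

`SplitFunctional.lean` (gen 21) kills the level-one space `F₁` with the functional
`Λ h = Σ_{n ∈ N} Σ_{i<r} ζ_r^i h(n q^i)` under the TRANSLATED ACTION (`q^i u = n_{i,u} u`: the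
`N⟨q⟩`-orbits are `N`-orbits).  Here the same functional is shown to kill `F₁` under the weaker,
purely stabiliser-theoretic hypothesis

* (`hfix`, NON-TRIVIAL FIXERS) every vector `u ∈ 𝔽_p^m` is fixed by some `n q^i` with `n ∈ N`
  and `0 < i < r`,

provided `K = N⟨q⟩` is a genuine extension: `q` normalises `N` (`hq : q ∈ Subgroup.normalizer (N : Set (GLm p m))`) and
`q^r ∈ N` (`hpow`).  [Proof: right multiplication by the fixer `s = n₀ q^{i₀}` of `u` permutes the
index set `N × [0,r)` — `(n,i) ↦ (n · q^i n₀ q^{-i} · q^{r⌊(i+i₀)/r⌋}, (i+i₀) mod r)` — preserving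
the condition `n q^i u = a` and multiplying the weight `ζ^i` by `ζ^{i₀} ≠ 1`; so the weighted count
`Λ t_{u,a}` equals `ζ^{i₀} Λ t_{u,a}`, i.e. vanishes.]  With `hone` (`n q^i = 1 ⇒ i = 0`, i.e. `r`
is the exact order of `q` modulo `N`) the functional is `1` on every level-one identity test, whence
(`no_design_of_splitFixers`):

**if `q ∈ N_G(N)`, `q^r ∈ N`, `r` is the order of `q` mod `N`, every vector has a fixer in
`K ∖ N` (`K = N⟨q⟩`), and every `k ∈ K ∖ 1` is a triple product `a b c` (`a ∈ H₁, b ∈ H₂, c ∈ H₃`),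
then `(H₁,H₂,H₃)` carries no level-one identity design.**  In character language: the linear
character `σ : K → K/N ≅ ℤ/r → ℂˣ` has no admissible vector (`AdmissibilityPrinciple`,
`FactoredAdmissibility`), but no character, quotient or abstract group is constructed — instances
only exhibit matrices.  The translated action implies `hfix` (`q u = n u` ⇒ `n⁻¹ q` fixes `u`), so
for genuine extensions this supersedes `SplitFunctional.no_design_of_split`.

Instance (file `MonomialFamilies.lean`): `N = T₁ = {diag(a,b,c) : abc = 1} ≤ GL₃(𝔽_p)`,
`q = −P` (`P` a `3`-cycle permutation matrix), `r = 6`: the group `T^± ⋊ A₃` of order `6(p-1)²`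
— at `p = 5` one of the two minimal non-carrier classes of order `96` found by the generation-21
GAP scan (ORACLE-g21 §G21-24) — lies in no member and is not factored `T₁ ⊆ H_a`, `q ∈ H_b`.

HONEST SCOPE.  Configuration exclusion; no `(p,m,ε)` cell is emptied.
-/

set_option linter.dupNamespace false

noncomputable section

open scoped BigOperators Classical Matrix

namespace Summit.MatrixMultiplication.MatrixMultiplication.Theorems.SubgroupIdentityDesigns.Negative
namespace SplitFixers

open Summit.MatrixMultiplication.MatrixMultiplication.Theorems.LieRankDesigns.Negative (GLm Mat)
open Summit.MatrixMultiplication.MatrixMultiplication.Theorems.LevelOneGL2Designs.Negative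
  (levelSubmodule)
open PackingBridge (exists_test)
open VectorTransportSpan (levelSubmodule_le_of_transport)
open SplitFunctional (Lam Lam_apply Lam_delta)

variable {p m : ℕ} [hp : Fact p.Prime]

omit hp in
/-- Conjugation by a power of a normalising element preserves `N`. -/
theorem conj_pow_mem {N : Subgroup (GLm p m)} {q : GLm p m} (hq : q ∈ Subgroup.normalizer (N : Set (GLm p m))) (i : ℕ)
    {n : GLm p m} (hn : n ∈ N) : q ^ i * n * (q ^ i)⁻¹ ∈ N :=
  (Subgroup.mem_normalizer_iff.mp (Subgroup.pow_mem _ hq i) n).mp hn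

omit hp in
/-- Normaliser membership from two-sided conjugation invariance (the form instances verify). -/
theorem mem_normalizer_of_conj {N : Subgroup (GLm p m)} {q : GLm p m}
    (h₁ : ∀ n ∈ N, q * n * q⁻¹ ∈ N) (h₂ : ∀ n ∈ N, q⁻¹ * n * q ∈ N) :
    q ∈ Subgroup.normalizer (N : Set (GLm p m)) :=
  Subgroup.mem_normalizer_iff.mpr fun n => by
    refine ⟨h₁ n, fun hn => ?_⟩
    have h := h₂ _ hn
    simpa only [mul_assoc, inv_mul_cancel_left, inv_mul_cancel, mul_one] using h

omit hp in
/-- `(q^r)^{⌊k/r⌋} q^{k mod r} = q^k`. -/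
theorem pow_div_mul_pow_mod (q : GLm p m) (r k : ℕ) :
    (q ^ r) ^ (k / r) * q ^ (k % r) = q ^ k := by
  rw [← pow_mul, ← pow_add, Nat.div_add_mod]

/-- **`Λ` KILLS EVERY VECTOR TRANSPORT under non-trivial fixers.** -/
theorem Lam_transport (N : Subgroup (GLm p m)) (q : GLm p m) {r : ℕ} {ζ : ℂ}
    (hζ : IsPrimitiveRoot ζ r) (hq : q ∈ Subgroup.normalizer (N : Set (GLm p m))) (hpow : q ^ r ∈ N)
    (hfix : ∀ u : Fin m → ZMod p, ∃ n ∈ N, ∃ i < r, i ≠ 0 ∧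
      ((((n : GLm p m) * q ^ i : GLm p m) : Mat p m) *ᵥ u = u))
    (u a : Fin m → ZMod p) :
    Lam N q r ζ (fun g : GLm p m => if (g : Mat p m) *ᵥ u = a then (1 : ℂ) else 0) = 0 := by
  obtain ⟨n₀, hn₀, i₀, hi₀, hi₀0, hfix0⟩ := hfix u
  have hr0 : 0 < r := by omega
  -- the summand, as a function on `N × Fin r`
  set F : N × Fin r → ℂ := fun x => ζ ^ ((x.2 : Fin r) : ℕ) *
      (if ((((x.1 : N) : GLm p m) * q ^ ((x.2 : Fin r) : ℕ) : GLm p m) : Mat p m) *ᵥ u = a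
        then (1 : ℂ) else 0) with hF
  have hS : Lam N q r ζ (fun g : GLm p m => if (g : Mat p m) *ᵥ u = a then (1 : ℂ) else 0) =
      ∑ x : N × Fin r, F x := by
    rw [Lam_apply, Fintype.sum_prod_type]
  -- right multiplication by the fixer `s = n₀ q^{i₀}`, as a self-map of the index set
  have hmem : ∀ x : N × Fin r, ((x.1 : N) : GLm p m) * (q ^ ((x.2 : Fin r) : ℕ) * n₀ *
      (q ^ ((x.2 : Fin r) : ℕ))⁻¹) * (q ^ r) ^ ((((x.2 : Fin r) : ℕ) + i₀) / r) ∈ N :=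
    fun x => N.mul_mem (N.mul_mem x.1.2 (conj_pow_mem hq _ hn₀)) (N.pow_mem hpow _)
  set Φ : N × Fin r → N × Fin r := fun x =>
    (⟨_, hmem x⟩, ⟨(((x.2 : Fin r) : ℕ) + i₀) % r, Nat.mod_lt _ hr0⟩) with hΦ
  -- the key identity: `Φ(n,i)` represents `n q^i · s`
  have hkey : ∀ x : N × Fin r, (((Φ x).1 : N) : GLm p m) * q ^ (((Φ x).2 : Fin r) : ℕ) =
      (x.1 : GLm p m) * q ^ ((x.2 : Fin r) : ℕ) * (n₀ * q ^ i₀) := by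
    intro x
    simp only [hΦ, Subgroup.coe_mk]
    rw [mul_assoc (((x.1 : N) : GLm p m) * _), pow_div_mul_pow_mod, pow_add]
    simp only [mul_assoc, inv_mul_cancel_left]
  have hinj : Function.Injective Φ := by
    intro x y hxy
    have h2 : ((x.2 : Fin r) : ℕ) = ((y.2 : Fin r) : ℕ) := by
      have := congrArg (fun z : N × Fin r => ((z.2 : Fin r) : ℕ)) hxy
      simp only [hΦ, Fin.val_mk] at this
      have hx := Nat.mod_eq_of_lt x.2.isLt
      have hy := Nat.mod_eq_of_lt y.2.isLt
      rw [← hx, ← hy]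
      exact Nat.ModEq.add_right_cancel' i₀ this
    have h1 := congrArg (fun z : N × Fin r => (((z.1 : N) : GLm p m))) hxy
    simp only [hΦ, Subgroup.coe_mk, h2] at h1
    have h1' : ((x.1 : N) : GLm p m) = ((y.1 : N) : GLm p m) :=
      mul_right_cancel (mul_right_cancel h1)
    exact Prod.ext (Subtype.ext h1') (Fin.ext h2)
  have hbij : Function.Bijective Φ := Finite.injective_iff_bijective.mp hinj
  -- reindex the sum by `Φ`
  have hre : ∑ x : N × Fin r, F x = ∑ x : N × Fin r, F (Φ x) :=
    (Fintype.sum_bijective Φ hbij (fun x => F (Φ x)) F fun _ => rfl).symm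
  -- and compare term by term: `F (Φ x) = ζ^{i₀} F x`
  have hterm : ∀ x : N × Fin r, F (Φ x) = ζ ^ i₀ * F x := by
    intro x
    have hval : ((((Φ x).1 : N) : GLm p m) * q ^ (((Φ x).2 : Fin r) : ℕ) : GLm p m) =
        (x.1 : GLm p m) * q ^ ((x.2 : Fin r) : ℕ) * (n₀ * q ^ i₀) := hkey x
    simp only [hF]
    rw [hval, Units.val_mul, ← Matrix.mulVec_mulVec, hfix0]
    have hpow' : ζ ^ ((((Φ x).2 : Fin r) : ℕ)) = ζ ^ i₀ * ζ ^ ((x.2 : Fin r) : ℕ) := by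
      show ζ ^ ((((x.2 : Fin r) : ℕ) + i₀) % r) = _
      rw [← pow_eq_pow_mod _ hζ.pow_eq_one, pow_add, mul_comm]
    rw [hpow', mul_assoc]
  have hsum : ∑ x : N × Fin r, F x = ζ ^ i₀ * ∑ x : N × Fin r, F x :=
    calc ∑ x : N × Fin r, F x = ∑ x : N × Fin r, F (Φ x) := hre
      _ = ∑ x : N × Fin r, ζ ^ i₀ * F x := Finset.sum_congr rfl fun x _ => hterm x
      _ = ζ ^ i₀ * ∑ x : N × Fin r, F x := by rw [Finset.mul_sum]
  have hζne : ζ ^ i₀ ≠ 1 := hζ.pow_ne_one_of_pos_of_lt hi₀0 hi₀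
  have hzero : (1 - ζ ^ i₀) * ∑ x : N × Fin r, F x = 0 := by
    rw [sub_mul, one_mul, ← hsum, sub_self]
  rw [hS]
  rcases mul_eq_zero.mp hzero with h | h
  · exact absurd (sub_eq_zero.mp h).symm hζne
  · exact h

variable {H₁ H₂ H₃ : Subgroup (GLm p m)}

/-- **SPLIT-FIXER EXCLUSION (cover form).**  `q ∈ N_G(N)`, `q^r ∈ N`, `r ≥ 2` the order of `q`
modulo `N` (`hone`), every vector fixed by some `n q^i` with `0 < i < r`; if every `n q^i ≠ 1` is a
triple product then no level-one identity design.  Every `p`, `m`, `ε`; no TPP. -/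
theorem no_design_of_splitFixers (N : Subgroup (GLm p m)) (q : GLm p m) {r : ℕ} (hr : 2 ≤ r)
    (hq : q ∈ Subgroup.normalizer (N : Set (GLm p m))) (hpow : q ^ r ∈ N)
    (hone : ∀ n ∈ N, ∀ i < r, (n : GLm p m) * q ^ i = 1 → i = 0)
    (hfix : ∀ u : Fin m → ZMod p, ∃ n ∈ N, ∃ i < r, i ≠ 0 ∧
      ((((n : GLm p m) * q ^ i : GLm p m) : Mat p m) *ᵥ u = u))
    (hcov : ∀ n ∈ N, ∀ i < r, (n : GLm p m) * q ^ i ≠ 1 →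
      ∃ a ∈ H₁, ∃ b ∈ H₂, ∃ c ∈ H₃, a * b * c = n * q ^ i) :
    ¬ ∃ c : Mat p m → ℂ, (∀ M, 1 < M.rank → c M = 0) ∧
      (∑ M, c M * ZMod.stdAddChar (Matrix.trace (M * ((1 : GLm p m) : Mat p m)))) = 1 ∧
      ∀ a ∈ H₁, ∀ b ∈ H₂, ∀ g ∈ H₃, a * b * g ≠ 1 →
        (∑ M, c M * ZMod.stdAddChar (Matrix.trace (M * ((a * b * g : GLm p m) : Mat p m)))) = 0 := by
  intro hdes
  obtain ⟨f, hf, h1, h0⟩ := exists_test hdes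
  set ζ : ℂ := Complex.exp (2 * Real.pi * Complex.I / r) with hζ_def
  have hprim : IsPrimitiveRoot ζ r := Complex.isPrimitiveRoot_exp r (by omega)
  have hker : levelSubmodule p m 1 ≤ LinearMap.ker (Lam N q r ζ) :=
    levelSubmodule_le_of_transport fun u a => by
      rw [LinearMap.mem_ker]
      exact Lam_transport N q hprim hq hpow hfix u a
  have hz : Lam N q r ζ f = 0 := LinearMap.mem_ker.mp (hker hf)
  have h0' : ∀ n ∈ N, ∀ i < r, (n : GLm p m) * q ^ i ≠ 1 → f (n * q ^ i) = 0 := by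
    intro n hn i hi hne
    obtain ⟨a, ha, b, hb, c, hc, habc⟩ := hcov n hn i hi hne
    rw [← habc]
    exact h0 a ha b hb c hc (habc ▸ hne)
  have hone' := Lam_delta N q hr ζ hone h1 h0'
  rw [hz] at hone'
  exact zero_ne_one hone'

/-- **`K = N⟨q⟩` IN ONE MEMBER**: `N ≤ H₁`, `q ∈ H₁`. -/
theorem no_design_of_splitFixers₁ (N : Subgroup (GLm p m)) (q : GLm p m) {r : ℕ} (hr : 2 ≤ r)
    (hq : q ∈ Subgroup.normalizer (N : Set (GLm p m))) (hpow : q ^ r ∈ N)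
    (hone : ∀ n ∈ N, ∀ i < r, (n : GLm p m) * q ^ i = 1 → i = 0)
    (hfix : ∀ u : Fin m → ZMod p, ∃ n ∈ N, ∃ i < r, i ≠ 0 ∧
      ((((n : GLm p m) * q ^ i : GLm p m) : Mat p m) *ᵥ u = u))
    (hN : N ≤ H₁) (hqH : q ∈ H₁) :
    ¬ ∃ c : Mat p m → ℂ, (∀ M, 1 < M.rank → c M = 0) ∧
      (∑ M, c M * ZMod.stdAddChar (Matrix.trace (M * ((1 : GLm p m) : Mat p m)))) = 1 ∧
      ∀ a ∈ H₁, ∀ b ∈ H₂, ∀ g ∈ H₃, a * b * g ≠ 1 →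
        (∑ M, c M * ZMod.stdAddChar (Matrix.trace (M * ((a * b * g : GLm p m) : Mat p m)))) = 0 :=
  no_design_of_splitFixers N q hr hq hpow hone hfix fun n hn i _ _ =>
    ⟨n * q ^ i, H₁.mul_mem (hN hn) (H₁.pow_mem hqH i), 1, H₂.one_mem, 1, H₃.one_mem,
      by rw [mul_one, mul_one]⟩

/-- **SPLIT `N ≤ H₁`, `q ∈ H₂`.** -/
theorem no_design_of_splitFixers₁₂ (N : Subgroup (GLm p m)) (q : GLm p m) {r : ℕ} (hr : 2 ≤ r)
    (hq : q ∈ Subgroup.normalizer (N : Set (GLm p m))) (hpow : q ^ r ∈ N)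
    (hone : ∀ n ∈ N, ∀ i < r, (n : GLm p m) * q ^ i = 1 → i = 0)
    (hfix : ∀ u : Fin m → ZMod p, ∃ n ∈ N, ∃ i < r, i ≠ 0 ∧
      ((((n : GLm p m) * q ^ i : GLm p m) : Mat p m) *ᵥ u = u))
    (hN : N ≤ H₁) (hqH : q ∈ H₂) :
    ¬ ∃ c : Mat p m → ℂ, (∀ M, 1 < M.rank → c M = 0) ∧
      (∑ M, c M * ZMod.stdAddChar (Matrix.trace (M * ((1 : GLm p m) : Mat p m)))) = 1 ∧
      ∀ a ∈ H₁, ∀ b ∈ H₂, ∀ g ∈ H₃, a * b * g ≠ 1 →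
        (∑ M, c M * ZMod.stdAddChar (Matrix.trace (M * ((a * b * g : GLm p m) : Mat p m)))) = 0 :=
  no_design_of_splitFixers N q hr hq hpow hone hfix fun n hn i _ _ =>
    ⟨n, hN hn, q ^ i, H₂.pow_mem hqH i, 1, H₃.one_mem, mul_one _⟩

/-- **SPLIT `N ≤ H₁`, `q ∈ H₃`.** -/
theorem no_design_of_splitFixers₁₃ (N : Subgroup (GLm p m)) (q : GLm p m) {r : ℕ} (hr : 2 ≤ r)
    (hq : q ∈ Subgroup.normalizer (N : Set (GLm p m))) (hpow : q ^ r ∈ N)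
    (hone : ∀ n ∈ N, ∀ i < r, (n : GLm p m) * q ^ i = 1 → i = 0)
    (hfix : ∀ u : Fin m → ZMod p, ∃ n ∈ N, ∃ i < r, i ≠ 0 ∧
      ((((n : GLm p m) * q ^ i : GLm p m) : Mat p m) *ᵥ u = u))
    (hN : N ≤ H₁) (hqH : q ∈ H₃) :
    ¬ ∃ c : Mat p m → ℂ, (∀ M, 1 < M.rank → c M = 0) ∧
      (∑ M, c M * ZMod.stdAddChar (Matrix.trace (M * ((1 : GLm p m) : Mat p m)))) = 1 ∧
      ∀ a ∈ H₁, ∀ b ∈ H₂, ∀ g ∈ H₃, a * b * g ≠ 1 →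
        (∑ M, c M * ZMod.stdAddChar (Matrix.trace (M * ((a * b * g : GLm p m) : Mat p m)))) = 0 :=
  no_design_of_splitFixers N q hr hq hpow hone hfix fun n hn i _ _ =>
    ⟨n, hN hn, 1, H₂.one_mem, q ^ i, H₃.pow_mem hqH i, by rw [mul_one]⟩

/-- **SPLIT `N ≤ H₂`, `q ∈ H₃`.** -/
theorem no_design_of_splitFixers₂₃ (N : Subgroup (GLm p m)) (q : GLm p m) {r : ℕ} (hr : 2 ≤ r)
    (hq : q ∈ Subgroup.normalizer (N : Set (GLm p m))) (hpow : q ^ r ∈ N)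
    (hone : ∀ n ∈ N, ∀ i < r, (n : GLm p m) * q ^ i = 1 → i = 0)
    (hfix : ∀ u : Fin m → ZMod p, ∃ n ∈ N, ∃ i < r, i ≠ 0 ∧
      ((((n : GLm p m) * q ^ i : GLm p m) : Mat p m) *ᵥ u = u))
    (hN : N ≤ H₂) (hqH : q ∈ H₃) :
    ¬ ∃ c : Mat p m → ℂ, (∀ M, 1 < M.rank → c M = 0) ∧
      (∑ M, c M * ZMod.stdAddChar (Matrix.trace (M * ((1 : GLm p m) : Mat p m)))) = 1 ∧
      ∀ a ∈ H₁, ∀ b ∈ H₂, ∀ g ∈ H₃, a * b * g ≠ 1 →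
        (∑ M, c M * ZMod.stdAddChar (Matrix.trace (M * ((a * b * g : GLm p m) : Mat p m)))) = 0 :=
  no_design_of_splitFixers N q hr hq hpow hone hfix fun n hn i _ _ =>
    ⟨1, H₁.one_mem, n, hN hn, q ^ i, H₃.pow_mem hqH i, by rw [one_mul]⟩

omit hp in
/-- With `q` normalising `N`, `n q^i = q^i n'` for some `n' ∈ N`; used for the reversed splits. -/
theorem exists_pow_mul (N : Subgroup (GLm p m)) {q : GLm p m} (hq : q ∈ Subgroup.normalizer (N : Set (GLm p m))) {n : GLm p m}
    (hn : n ∈ N) (i : ℕ) : ∃ n' ∈ N, n * q ^ i = q ^ i * n' := by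
  refine ⟨(q ^ i)⁻¹ * n * q ^ i, ?_, by group⟩
  have h := conj_pow_mem (Subgroup.inv_mem _ hq) i hn
  simpa only [inv_pow, inv_inv] using h

/-- **SPLIT `q ∈ H₁`, `N ≤ H₂`.** -/
theorem no_design_of_splitFixers₂₁ (N : Subgroup (GLm p m)) (q : GLm p m) {r : ℕ} (hr : 2 ≤ r)
    (hq : q ∈ Subgroup.normalizer (N : Set (GLm p m))) (hpow : q ^ r ∈ N)
    (hone : ∀ n ∈ N, ∀ i < r, (n : GLm p m) * q ^ i = 1 → i = 0)
    (hfix : ∀ u : Fin m → ZMod p, ∃ n ∈ N, ∃ i < r, i ≠ 0 ∧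
      ((((n : GLm p m) * q ^ i : GLm p m) : Mat p m) *ᵥ u = u))
    (hqH : q ∈ H₁) (hN : N ≤ H₂) :
    ¬ ∃ c : Mat p m → ℂ, (∀ M, 1 < M.rank → c M = 0) ∧
      (∑ M, c M * ZMod.stdAddChar (Matrix.trace (M * ((1 : GLm p m) : Mat p m)))) = 1 ∧
      ∀ a ∈ H₁, ∀ b ∈ H₂, ∀ g ∈ H₃, a * b * g ≠ 1 →
        (∑ M, c M * ZMod.stdAddChar (Matrix.trace (M * ((a * b * g : GLm p m) : Mat p m)))) = 0 :=
  no_design_of_splitFixers N q hr hq hpow hone hfix fun n hn i _ _ => by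
    obtain ⟨n', hn', h⟩ := exists_pow_mul N hq hn i
    exact ⟨q ^ i, H₁.pow_mem hqH i, n', hN hn', 1, H₃.one_mem, by rw [mul_one, h]⟩

/-- **SPLIT `q ∈ H₁`, `N ≤ H₃`.** -/
theorem no_design_of_splitFixers₃₁ (N : Subgroup (GLm p m)) (q : GLm p m) {r : ℕ} (hr : 2 ≤ r)
    (hq : q ∈ Subgroup.normalizer (N : Set (GLm p m))) (hpow : q ^ r ∈ N)
    (hone : ∀ n ∈ N, ∀ i < r, (n : GLm p m) * q ^ i = 1 → i = 0)
    (hfix : ∀ u : Fin m → ZMod p, ∃ n ∈ N, ∃ i < r, i ≠ 0 ∧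
      ((((n : GLm p m) * q ^ i : GLm p m) : Mat p m) *ᵥ u = u))
    (hqH : q ∈ H₁) (hN : N ≤ H₃) :
    ¬ ∃ c : Mat p m → ℂ, (∀ M, 1 < M.rank → c M = 0) ∧
      (∑ M, c M * ZMod.stdAddChar (Matrix.trace (M * ((1 : GLm p m) : Mat p m)))) = 1 ∧
      ∀ a ∈ H₁, ∀ b ∈ H₂, ∀ g ∈ H₃, a * b * g ≠ 1 →
        (∑ M, c M * ZMod.stdAddChar (Matrix.trace (M * ((a * b * g : GLm p m) : Mat p m)))) = 0 :=
  no_design_of_splitFixers N q hr hq hpow hone hfix fun n hn i _ _ => by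
    obtain ⟨n', hn', h⟩ := exists_pow_mul N hq hn i
    exact ⟨q ^ i, H₁.pow_mem hqH i, 1, H₂.one_mem, n', hN hn', by rw [mul_one, h]⟩

/-- **SPLIT `q ∈ H₂`, `N ≤ H₃`.** -/
theorem no_design_of_splitFixers₃₂ (N : Subgroup (GLm p m)) (q : GLm p m) {r : ℕ} (hr : 2 ≤ r)
    (hq : q ∈ Subgroup.normalizer (N : Set (GLm p m))) (hpow : q ^ r ∈ N)
    (hone : ∀ n ∈ N, ∀ i < r, (n : GLm p m) * q ^ i = 1 → i = 0)
    (hfix : ∀ u : Fin m → ZMod p, ∃ n ∈ N, ∃ i < r, i ≠ 0 ∧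
      ((((n : GLm p m) * q ^ i : GLm p m) : Mat p m) *ᵥ u = u))
    (hqH : q ∈ H₂) (hN : N ≤ H₃) :
    ¬ ∃ c : Mat p m → ℂ, (∀ M, 1 < M.rank → c M = 0) ∧
      (∑ M, c M * ZMod.stdAddChar (Matrix.trace (M * ((1 : GLm p m) : Mat p m)))) = 1 ∧
      ∀ a ∈ H₁, ∀ b ∈ H₂, ∀ g ∈ H₃, a * b * g ≠ 1 →
        (∑ M, c M * ZMod.stdAddChar (Matrix.trace (M * ((a * b * g : GLm p m) : Mat p m)))) = 0 :=
  no_design_of_splitFixers N q hr hq hpow hone hfix fun n hn i _ _ => by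
    obtain ⟨n', hn', h⟩ := exists_pow_mul N hq hn i
    exact ⟨1, H₁.one_mem, q ^ i, H₂.pow_mem hqH i, n', hN hn', by rw [one_mul, h]⟩

/-- The translated action of `SplitFunctional` implies non-trivial fixers (`r ≥ 2`, `N` a group):
`q u = n u` gives the fixer `n⁻¹ q` of `u`. -/
theorem fixers_of_translate (N : Subgroup (GLm p m)) (q : GLm p m) {r : ℕ} (hr : 2 ≤ r)
    (htr : ∀ u : Fin m → ZMod p, ∃ n ∈ N, ((q : GLm p m) : Mat p m) *ᵥ u = ((n : GLm p m) : Mat p m) *ᵥ u) :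
    ∀ u : Fin m → ZMod p, ∃ n ∈ N, ∃ i < r, i ≠ 0 ∧
      ((((n : GLm p m) * q ^ i : GLm p m) : Mat p m) *ᵥ u = u) := by
  intro u
  obtain ⟨n, hn, h⟩ := htr u
  refine ⟨n⁻¹, N.inv_mem hn, 1, by omega, one_ne_zero, ?_⟩
  rw [pow_one, Units.val_mul, ← Matrix.mulVec_mulVec, h, Matrix.mulVec_mulVec, ← Units.val_mul,
    inv_mul_cancel, Units.val_one, Matrix.one_mulVec]

end SplitFixers
end Summit.MatrixMultiplication.MatrixMultiplication.Theorems.SubgroupIdentityDesigns.Negative
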